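import Literature.MathematicalPhysics.QuantumFieldTheory.Balaban1983to89.Node00.OpsYSectDCoords
import Literature.MathematicalPhysics.QuantumFieldTheory.Balaban1983to89.Node00.OpsYNablaBridge
import Literature.MathematicalPhysics.QuantumFieldTheory.Balaban1983to89.B9Eq340NearPairBlocks
import Literature.MathematicalPhysics.QuantumFieldTheory.Balaban1983to89.B9CoReadingCoordsS
import Literature.MathematicalPhysics.QuantumFieldTheory.Balaban1983to89.B9GeoLemma21KLevelV1

/-!
# `Balaban1983to89.B9GradViaDivLettersAtPins` — [B9] (3.3) p. 390 ∕ (3.8) p. 392 at node00-def-Y's letters: THE COVARIANT GRADIENT OF THE GAUGE SECTOR IS A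
# FINITE SUM OF THE BOND-SECTOR DIRECTION LETTERS ∇*_{U,μ} AFTER ONE KINEMATIC EMBEDDING, `D_U = Σ_μ ∇*_{U,μ} ∘ J_μ(U)`; the coordinate models at the
# N06 certificate's pins (`DvcoKH = Σ_μ Dsd μ ∘ JcoKH μ`, `DcoK = Σ_ν Π_ν ∘ Dd ν`) and the sup majorant of `J_μ` (the `hJ` of `B9Thm313WholeDvFromDds`)

T. Bałaban, *Propagators for lattice gauge theories in a background field*, Commun. Math. Phys. **99** (1985) 389–434
[`Balaban1985BackgroundPropagators`, "B9"]; [4] = T. Bałaban, *Propagators and renormalization transformations for lattice gauge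
theories. II*, Commun. Math. Phys. **96** (1984) 223–250 [`Balaban1984PropagatorsII`].

statement-level skeleton of published theorems with citation tags; proofs where landed; nothing here is a claim about the Yang–Mills
mass gap

THE PRINTED LOCUS (held text `paper:balaban1985-cmp99-background-propagators`).  (3.3) p. 390: *"(D_Uλ)(b) = η⁻¹(U(b)λ(b₊) − λ(b₋)) … we
identify a function A on bonds with the vector function A_μ(x) = A(⟨x, x + ηe_μ⟩) … (D_{U,μ}λ)(x) = (D_Uλ)(⟨x, x+ηe_μ⟩)"*; (3.8) p. 392: the adjoint
derivatives `D*_{U,μ}` along reversed bonds, componentwise on vector functions; (3.5) p. 391: `U(x, x−e_μ) = U(x−e_μ, x)⁻¹`; p. 398 (remark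
after (3.47)): *"we may always replace ∇_U by ∇*_U … in arbitrary place"*; (3.133) p. 422 and (3.152)–(3.153) p. 426 (the operators G₀D_U,
∇_UG₀D_U of the Sect.-D expansions); [4] (2.45)–(2.46) p. 231, (2.51) p. 232 (block maps and majorants).

THE POINT.  n06-l's `B9Thm313WholeDvFromDds` turns five displayed Sect.-D letter fields of rows 20–21 (`Letters313Z.gD1∕gD2`, `Letters313L2PZ.gDv∕dGDv`,
`Letters313L2MZ.dGDvd`) into theorems of rows 19's derived `Thm33G0DirR ∕ Thm33G0L2M` modulo TWO KINEMATIC HYPOTHESES: `hDv : Dv = Σ_μ Dds μ ∘ₗ J μ`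
with a block-local sup majorant `hJ` (and block-L² `hJL2`) of `J μ`, and `hD : D = Σ_ν Π ν ∘ₗ Dd ν` with the block bound `hPr` of the slice projectors.
THIS FILE discharges them at node00-def-Y's GENUINE letters and the certificate's pins (`hDvco12 ∕ h𝔡As ∕ hDco12 ∕ h𝔡Ad ∕ hblk12 ∕ hblkW12 ∕ hβ1`, ed. 27):
* §1 the 𝔸-level letter `Jb i U μ : (SiteY i → 𝔸) →ₗ[ℂ] (FBondY i → 𝔸)`, `(J_μΦ)(b′) = −δ_{b′.dir = μ}·R(U_μ(b′₋))Φ(chart(b′₋ + e_μ))`, and ★★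
  `gradY_apply_eq_sum_cdsB_Jb` ∕ `gradY_restrict_eq_sum`: `D_U = Σ_μ ∇*_{U,μ} ∘ J_μ` EXACTLY (def-Y's `gradY` against def-Y's componentwise `cdsB`; the
  transporter `R(U_μ)⁻¹R(U_μ) = 1` cancels, (3.5));
* §2 the coordinate models: `coordOpKH_fsum`, the direction-slice projector `sliceProjK ν` with ★ `coordOpK_eq_sum_sliceProj` (a slice-diagonal family
  IS the sum of its slices' constant families), `JcoKH := coordOpKH b (fun _ => J_μ)` (slice-preserving), ★★ `DvcoKH_eq_sum`
  (`DvcoKH = Σ_μ coordOpK b (fun _ => cdsBₗ μ) ∘ₗ JcoKH μ` — the certificate's `hDv` after `hDvco12 ∕ h𝔡As`), ★ `DcoK_eq_sum` (its `hD` after `hDco12 ∕ h𝔡Ad`);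
* §3 the sup majorant: `J_μ` reads ONE transported neighbour value, so for contracting link variables (`‖U_b‖, ‖U_b⁻¹‖ ≤ 1` — every `SU(N)`-valued
  `Reg335` configuration) `|(J_μλ)(b′, ν, c, c′)| ≤ cR39 b · |λ|` on the block of the neighbour (the reading constant `cR39 = coordBound·basisBound·|κ|` of
  `B9Thm39ReadingCoords`), and that block is within `rJ = (d+1)(L+1)+2` of the bond's index block (n06-w6 `B9Eq340NearPairBlocks.near_dist_carrier_le` at
  sup-distance `1`, under the 1-faithfulness pin `hβ1`): ★★ `hasMajorantHom_JcoKH`, ★★ `hasMaj_JcoKH` (class form `𝔠_W⁽⁰⁾ → 𝔠⁽⁰⁾`, kernel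
  `cR39 b·e^{δ·rJ}·e^{−δd}`, every `δ ≥ 0`), ★★ `hasMaj_JcoKH_pins` (every member, every `Reg335` configuration, at `trBasis N`).
The block-L² twins (`blockBd_JcoKH`, `blockBd_sliceProjK`) are the companion `B9GradViaDivLettersAtPinsL2`.

HONEST SCOPE.  Instance-side kinematic bookkeeping at def-Y's letters: one exact identity of lattice calculus and the sup size of a one-term transported
shift; nothing of [B9]'s propagator estimates asserted; COUNT-NEUTRAL; N06 NOT discharged; one finite lattice at a time; nothing continuum, nothing about
the mass gap.  Cell `pub-ymgap` (HUMAN RULING D-0062), Track A node N06 [B9], rows 20–21 (bundle F7), seat `pub-ymgap-dag-n06-l` (g17), 2026-08-28.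
-/

noncomputable section

namespace Literature.MathematicalPhysics.QuantumFieldTheory.Balaban1983to89.B9GradViaDivLettersAtPins

open Node00 B6GlobalChartV1 B6KLevelCensusIndexV1 B9BackgroundsKLevelV1
open B9Eq39Adjoint (R R_zero R_neg R_inv_R R_add R_smul)
open Node00.OpsYNablaBridge (chartY shiftY_chartY gradY_apply_eq_cdS cdS_apply shift_unshift unshift_shift sum_bond_eq)
open B9CoReadingCoords (XBK coordOpK cdBₗ cdsBₗ cdsBₗ_apply assembleK blkBK coordOpK_apply)
open B9CoReadingCoordsH (coordOpKH coordOpKH_apply coordOpK_comp_coordOpKH)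
open B9CoReadingCoordsS (XSK blkSK sIK)
open Node00.OpsYSectDCoords (DvcoKH)
open LatticeFieldCalculus (supDist shiftEquiv)
open B6Geom246MultiLevelTorus (geomT)
open B6Ineq2142KLevelV1 (β lvl)
open B9GeoNormsKLevelV1 (geo9K)
open B9GeoLemma21KLevelV1 (geo9K_dist_self)
open B9Eq340NearPairBlocks (near_dist_carrier_le)
open B9Thm39ReadingCoords (cR39 cR39_nonneg coordBound39 basisBound39 abs_repr_le norm_sum_smul_basis_le)
open B9Thm34Ext (toB6)
open B9SectDSup (weightNorm)
open B11SectG (HasMaj BlockNorm)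
open B9Thm312Whole (cNorm wt wt_nonneg)
open B6RandomWalkHom (HasMajorantHom)

variable {𝔸 : Type} [NormedRing 𝔸] [NormedAlgebra ℂ 𝔸] [CompleteSpace 𝔸]
variable {d ℓ : ℕ} {hd : 1 ≤ d + 1} {hL : Odd (ℓ + 1) ∧ 1 < ℓ + 1} {b₀ b₁ : ℝ}
variable (i : KIdx d ℓ hd hL b₀ b₁)

/-! ## §1 The 𝔸-level letter `J_μ(U)` and the identity `D_U = Σ_μ ∇*_{U,μ} ∘ J_μ(U)` -/

/-- **THE KINEMATIC EMBEDDING `J_μ(U)`: scalar (site) functions → vector (bond) functions** — `(J_μΦ)(b′) = −R(U_μ(b′₋))·Φ(chart(b′₋ + e_μ))` on the bonds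
of direction `μ`, `0` on the others: one parallel-transported neighbour value placed into the `μ`-component (so that `∇*_{U,μ}J_μΦ` is the `μ`-component
`∇_{U,μ}Φ` of `D_UΦ`, p. 398's *"replace ∇_U by ∇*_U"* made an operator identity). [cite: Balaban1985BackgroundPropagators, (3.3) p.390, (3.5) p.391, (3.8) p.392, p.398 (remark after (3.47))] -/
def Jb (U : CfgY 𝔸 i) (μ : Fin (d + 1)) : (SiteY i → 𝔸) →ₗ[ℂ] (FBondY i → 𝔸) where
  toFun Φ := fun b' => if b'.dir = μ then -R (U μ b'.src) (Φ (chartY i (b'.src.shift μ))) else 0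
  map_add' Φ Ψ := by
    funext b'
    by_cases h : b'.dir = μ
    · simp only [h, if_true, Pi.add_apply, R_add, neg_add_rev]
      abel
    · simp only [h, if_false, Pi.add_apply, add_zero]
  map_smul' c Φ := by
    funext b'
    by_cases h : b'.dir = μ
    · simp only [h, if_true, Pi.smul_apply, R_smul, smul_neg, RingHom.id_apply]
    · simp only [h, if_false, Pi.smul_apply, smul_zero, RingHom.id_apply]

/-- `J_μ(U)`, evaluated. [cite: Balaban1985BackgroundPropagators, (3.3) p.390, bookkeeping] -/
theorem Jb_apply (U : CfgY 𝔸 i) (μ : Fin (d + 1)) (Φ : SiteY i → 𝔸) (b' : FBondY i) :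
    Jb i U μ Φ b' = if b'.dir = μ then -R (U μ b'.src) (Φ (chartY i (b'.src.shift μ))) else 0 := rfl

/-- def-Y's `cdsB` unfolded at a bond: `(∇*_{U,μ}A)_ν(x) = c_f·(R(U_μ(x − e_μ))⁻¹A_ν(x − e_μ) − A_ν(x))`. [cite: Balaban1985BackgroundPropagators, (3.8) p.392, (3.5) p.391, bookkeeping] -/
theorem cdsB_apply' (U : CfgY 𝔸 i) (μ : Fin (d + 1)) (A : FBondY i → 𝔸) (b : FBondY i) :
    cdsB i U μ A b = ((i.cf : ℝ) : ℂ) • (R (U μ (b.src.unshift μ))⁻¹ (A ⟨b.src.unshift μ, b.dir⟩) - A b) := by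
  rfl

/-- ★★ **(3.3) AS A SUM OVER THE DIRECTION LETTERS OF (3.8): `(D_UΦ)(b) = Σ_μ (∇*_{U,μ} J_μ(U)Φ)(b)`** — only `μ = b.dir` contributes, and there
`c_f·(R(U_μ(x−e_μ))⁻¹(−R(U_μ(x−e_μ))Φ̂(x)) + R(U_μ(x))Φ̂(x+e_μ)) = c_f·(R(U(b))Φ̂(b₊) − Φ̂(b₋))`, the transporters cancelling by (3.5).
[cite: Balaban1985BackgroundPropagators, (3.3) p.390, (3.5) p.391, (3.8) p.392, p.398 (remark after (3.47))] -/
theorem gradY_apply_eq_sum_cdsB_Jb (U : CfgY 𝔸 i) (Φ : SiteY i → 𝔸) (b : FBondY i) :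
    gradY i U Φ b = ∑ μ : Fin (d + 1), cdsB i U μ (Jb i U μ Φ) b := by
  obtain ⟨s, ν⟩ := b
  rw [Finset.sum_eq_single ν]
  · rw [gradY_apply_eq_cdS, cdS_apply, shiftY_chartY, Equiv.symm_apply_apply, cdsB_apply', Jb_apply, Jb_apply]
    simp only [if_true, shift_unshift, R_neg, R_inv_R, sub_neg_eq_add]
    rw [neg_add_eq_sub]
  · intro μ _ hμ
    rw [cdsB_apply', Jb_apply, Jb_apply, if_neg (Ne.symm hμ), if_neg (Ne.symm hμ), R_zero, sub_zero, smul_zero]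
  · intro h; exact absurd (Finset.mem_univ ν) h

/-- ★ **THE OPERATOR FORM: `D_U = Σ_μ ∇*_{U,μ} ∘ J_μ(U)`** (ℝ-linear maps `(SiteY i → 𝔸) → (FBondY i → 𝔸)`; def-Y's `gradY` against n06-d's ℝ-linear `cdsBₗ`).
[cite: Balaban1985BackgroundPropagators, (3.3) p.390, (3.8) p.392, p.398 (remark after (3.47))] -/
theorem gradY_restrict_eq_sum (U : CfgY 𝔸 i) :
    (gradY i U).restrictScalars ℝ = ∑ μ : Fin (d + 1), cdsBₗ i U μ ∘ₗ (Jb i U μ).restrictScalars ℝ := by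
  apply LinearMap.ext
  intro Φ
  funext b'
  simp only [LinearMap.restrictScalars_apply, LinearMap.sum_apply, Finset.sum_apply, LinearMap.comp_apply, cdsBₗ_apply]
  exact gradY_apply_eq_sum_cdsB_Jb i U Φ b'

/-! ## §2 The coordinate models: `JcoKH`, the slice projectors, `DvcoKH = Σ_μ Dsd μ ∘ JcoKH μ`, `DcoK = Σ_ν Π_ν ∘ Dd ν` -/

section Coords

variable {κ : Type} [Fintype κ] (b : Module.Basis κ ℝ 𝔸)

omit [CompleteSpace 𝔸] in
/-- The mixed coordinate model is additive in the operator family (finite sums). [cite: Balaban1985BackgroundPropagators, (3.126) p.420, dictionary; Balaban1984PropagatorsII, (2.51) p.232] -/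
theorem coordOpKH_fsum {S S' D ι : Type} (s : Finset ι) (T : ι → D → (S' → 𝔸) →ₗ[ℝ] (S → 𝔸)) :
    coordOpKH b (fun ν => ∑ j ∈ s, T j ν) = ∑ j ∈ s, coordOpKH b (fun ν => T j ν) := by
  apply LinearMap.ext
  intro f
  funext p
  simp only [coordOpKH_apply, LinearMap.sum_apply, Finset.sum_apply, map_sum, Finsupp.coe_finsetSum]

/-- **THE DIRECTION-SLICE PROJECTOR `Π_ν`** on a κ-fold coordinate carrier `S × D × κ × κ`: keep the slice `ν`, zero the others (the kinematic letter writing a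
slice-DIAGONAL family as the sum of its slices' CONSTANT families). [cite: Balaban1985BackgroundPropagators, (3.42) p.397 («∇_U G(U)», all directions), dictionary; Balaban1984PropagatorsII, (2.51) p.232] -/
def sliceProjK {S D : Type} [DecidableEq D] (ν : D) : (S × D × κ × κ → ℝ) →ₗ[ℝ] (S × D × κ × κ → ℝ) where
  toFun f := fun p => if p.2.1 = ν then f p else 0
  map_add' f f' := by
    funext p
    by_cases h : p.2.1 = ν <;> simp [h]
  map_smul' r f := by
    funext p
    by_cases h : p.2.1 = ν <;> simp [h]

omit [Fintype κ] in
/-- `Π_ν`, evaluated. [cite: Balaban1985BackgroundPropagators, (3.42) p.397, dictionary] -/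
theorem sliceProjK_apply {S D : Type} [DecidableEq D] (ν : D) (f : S × D × κ × κ → ℝ) (p : S × D × κ × κ) :
    sliceProjK (κ := κ) ν f p = if p.2.1 = ν then f p else 0 := rfl

omit [CompleteSpace 𝔸] in
/-- ★ **A SLICE-DIAGONAL COORDINATE MODEL IS THE SUM OF ITS SLICES' CONSTANT MODELS**: `coordOpK b T = Σ_ν Π_ν ∘ coordOpK b (fun _ => T ν)`.
[cite: Balaban1985BackgroundPropagators, (3.42) p.397, dictionary; Balaban1984PropagatorsII, (2.51) p.232] -/
theorem coordOpK_eq_sum_sliceProj {S D : Type} [Fintype D] [DecidableEq D] (T : D → (S → 𝔸) →ₗ[ℝ] (S → 𝔸)) :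
    coordOpK b T = ∑ ν, sliceProjK ν ∘ₗ coordOpK b (fun _ : D => T ν) := by
  apply LinearMap.ext
  intro f
  funext p
  simp only [coordOpK_apply, LinearMap.sum_apply, Finset.sum_apply, LinearMap.comp_apply, sliceProjK_apply]
  rw [Finset.sum_ite_eq Finset.univ p.2.1 (fun ν => b.repr ((T ν) (assembleK b p.2.1 p.2.2.2 f) p.1) p.2.2.1)]
  simp

variable (B : B9.Backgrounds) (cfg : B.Cfg → CfgY 𝔸 i)

/-- ★ **`J_μ(U₁)` IN COORDINATES** (sites `XSK` → bonds `XBK`, slice-PRESERVING): `coordOpKH b (fun _ => J_μ(U₁))` — the operator the N06 certificate displays as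
the kinematic letter `J` of `B9Thm313WholeDvFromDds` once `Dv` is pinned to def-Y's `DvcoKH`. [cite: Balaban1985BackgroundPropagators, (3.3) p.390, (3.133) p.422; Balaban1984PropagatorsII, (2.51) p.232] -/
def JcoKH (μ : Fin (d + 1)) (U₁ : B.Cfg) : (XSK κ i → ℝ) →ₗ[ℝ] (XBK κ i → ℝ) :=
  coordOpKH b (fun _ : Fin (d + 1) => (Jb i (cfg U₁) μ).restrictScalars ℝ)

/-- `JcoKH`, evaluated: the coordinate `c` of `J_μ(U₁)` applied to the re-assembled `(ν, ·, c′)`-slice. [cite: Balaban1985BackgroundPropagators, (3.3) p.390, dictionary] -/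
theorem JcoKH_apply (μ : Fin (d + 1)) (U₁ : B.Cfg) (lam : XSK κ i → ℝ) (p : XBK κ i) :
    JcoKH i b B cfg μ U₁ lam p = b.repr (Jb i (cfg U₁) μ (assembleK b p.2.1 p.2.2.2 lam) p.1) p.2.2.1 := rfl

/-- ★★ **THE CERTIFICATE'S `hDv` AT THE PINS: `DvcoKH = Σ_μ coordOpK b (fun _ => ∇*_{U,μ}) ∘ JcoKH μ`** — def-Y's model of the gauge-sector `D_U` (`hDvco12`) IS
the sum over the directions of the bond-sector direction letters `(𝔡A x).Dsd U μ = coordOpK b (fun _ => cdsBₗ U μ)` (`h𝔡As`) composed with `JcoKH μ`.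
[cite: Balaban1985BackgroundPropagators, (3.3) p.390, (3.8) p.392, p.398 (remark after (3.47)), (3.133) p.422] -/
theorem DvcoKH_eq_sum (U₁ : B.Cfg) :
    DvcoKH i b B cfg U₁ = ∑ μ : Fin (d + 1), coordOpK b (fun _ : Fin (d + 1) => cdsBₗ i (cfg U₁) μ) ∘ₗ JcoKH i b B cfg μ U₁ := by
  calc DvcoKH i b B cfg U₁ = coordOpKH b (fun _ : Fin (d + 1) => (gradY i (cfg U₁)).restrictScalars ℝ) := rfl
    _ = coordOpKH b (fun _ : Fin (d + 1) => ∑ μ : Fin (d + 1), cdsBₗ i (cfg U₁) μ ∘ₗ (Jb i (cfg U₁) μ).restrictScalars ℝ) := by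
        rw [gradY_restrict_eq_sum]
    _ = ∑ μ : Fin (d + 1), coordOpKH b (fun _ : Fin (d + 1) => cdsBₗ i (cfg U₁) μ ∘ₗ (Jb i (cfg U₁) μ).restrictScalars ℝ) :=
        coordOpKH_fsum b Finset.univ (fun μ (_ : Fin (d + 1)) => cdsBₗ i (cfg U₁) μ ∘ₗ (Jb i (cfg U₁) μ).restrictScalars ℝ)
    _ = _ := by simp only [JcoKH, coordOpK_comp_coordOpKH]

/-- ★ **THE CERTIFICATE'S `hD` AT THE PINS: `DcoK = Σ_ν Π_ν ∘ coordOpK b (fun _ => ∇_{U,ν})`** — n06-d's slice-diagonal model of `∇_U` (`hDco12`) IS the sum of the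
slice projectors after the direction letters `(𝔡A x).Dd U ν` (`h𝔡Ad`). [cite: Balaban1985BackgroundPropagators, (3.3) p.390, (3.42) p.397 («∇_UG(U)»)] -/
theorem DcoK_eq_sum (U₁ : B.Cfg) :
    B9CoReadingCoords.DcoK i b B cfg U₁ = ∑ ν : Fin (d + 1), sliceProjK ν ∘ₗ coordOpK b (fun _ : Fin (d + 1) => cdBₗ i (cfg U₁) ν) :=
  coordOpK_eq_sum_sliceProj b _

end Coords

/-! ## §3 The sup majorant of `J_μ`: one transported neighbour value, within `rJ = (d+1)(L+1)+2` index blocks -/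

section Sup

variable {κ : Type} [Fintype κ] (b : Module.Basis κ ℝ 𝔸) [FiniteDimensional ℝ 𝔸] (B : B9.Backgrounds) (cfg : B.Cfg → CfgY 𝔸 i)
variable {bI : FBondY i → IBondY i}

omit [NormedAlgebra ℂ 𝔸] [CompleteSpace 𝔸] [FiniteDimensional ℝ 𝔸] in
/-- A unit that is a norm contraction together with its inverse conjugates contractively: `‖g v g⁻¹‖ ≤ ‖v‖` (private twin of n06-w5's lemma). [folklore] -/
private theorem norm_R_le_of_contraction' {g : 𝔸ˣ} (h1 : ‖(g : 𝔸)‖ ≤ 1) (h2 : ‖((g⁻¹ : 𝔸ˣ) : 𝔸)‖ ≤ 1) (v : 𝔸) :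
    ‖R g v‖ ≤ ‖v‖ := by
  unfold R
  calc ‖(g : 𝔸) * v * ((g⁻¹ : 𝔸ˣ) : 𝔸)‖ ≤ ‖(g : 𝔸) * v‖ * ‖((g⁻¹ : 𝔸ˣ) : 𝔸)‖ := norm_mul_le _ _
    _ ≤ (‖(g : 𝔸)‖ * ‖v‖) * ‖((g⁻¹ : 𝔸ˣ) : 𝔸)‖ := mul_le_mul_of_nonneg_right (norm_mul_le _ _) (norm_nonneg _)
    _ ≤ (1 * ‖v‖) * 1 :=
        mul_le_mul (mul_le_mul_of_nonneg_right h1 (norm_nonneg _)) h2 (norm_nonneg _) (by positivity)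
    _ = ‖v‖ := by ring

/-- **THE RADIUS OF `J_μ`** in index blocks: `rJ = (d+1)(L+1) + 2` (n06-w6's near-pair radius at sup-distance `1`). [cite: Balaban1984PropagatorsII, (2.46) p.231; Balaban1985BackgroundPropagators, (3.40) p.397, bookkeeping] -/
def rJ (d ℓ : ℕ) : ℝ := ((d : ℝ) + 1) * (((ℓ : ℝ) + 1) + 1) + 2

omit [CompleteSpace 𝔸] in
/-- adjacent torus sites are at sup-distance `≤ 1` (adapted from `B6BlockDecayHprimeCovV1.supDist_unshift_le_one`). [cite: Balaban1984PropagatorsII, (2.1) p.224, bookkeeping] -/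
theorem supDist_shift_le_one (s : Site (PV d ℓ i.m i.K hd hL) 0) (μ : Fin (d + 1)) : supDist s (s.shift μ) ≤ 1 := by
  have h : supDist ((s.shift μ).unshift μ) (s.shift μ) ≤ 1 := by
    unfold supDist
    refine Finset.sup_le fun ν _ => ?_
    simp only [Site.unshift]
    by_cases hν : ν = μ
    · subst hν
      rw [Function.update_self, sub_sub_cancel_left, sub_sub_cancel]
      refine (min_le_right _ _).trans ?_
      rw [ZMod.val_one_eq_one_mod]
      exact Nat.mod_le 1 _
    · rw [Function.update_of_ne hν, sub_self, ZMod.val_zero]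
      exact (min_le_left _ _).trans (Nat.zero_le _)
  rwa [unshift_shift] at h

omit [CompleteSpace 𝔸] in
/-- **THE NEIGHBOUR'S SITE BLOCK IS WITHIN `rJ` OF THE BOND'S INDEX BLOCK**: for a 1-faithful carrier map `bI` (`hβ1`), `d(bI⟨x, ν⟩, sIK bI (chart(x + e_μ))) ≤ rJ`
(n06-w6's `near_dist_carrier_le` at the pair `⟨x, ν⟩`, `⟨x + e_μ, e₀⟩`). [cite: Balaban1984PropagatorsII, (2.45)–(2.46) p.231; Balaban1985BackgroundPropagators, (3.40) p.397] -/
theorem dist_bI_sIK_shift_le (hβ1 : ∀ f : FBondY i, (geomT i.D).dist (β i.hN i.D i.hk (bI f)) (blkV1 i.hN i.D f) ≤ 1)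
    (s : Site (PV d ℓ i.m i.K hd hL) 0) (μ ν : Fin (d + 1)) :
    (geo9K i).dist (bI ⟨s, ν⟩) (sIK i bI (chartY i (s.shift μ))) ≤ rJ d ℓ := by
  have hnear : supDist (⟨s, ν⟩ : FBondY i).src (⟨s.shift μ, 0⟩ : FBondY i).src ≤ (ℓ + 1) ^ (blkV1 i.hN i.D (⟨s, ν⟩ : FBondY i)).1.1 :=
    (supDist_shift_le_one i s μ).trans (Nat.one_le_pow _ _ (Nat.succ_pos ℓ))
  have e : sIK i bI (chartY i (s.shift μ)) = bI ⟨s.shift μ, 0⟩ := by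
    show bI ⟨(boxEquiv i.hN).symm (boxEquiv i.hN (s.shift μ)), 0⟩ = bI ⟨s.shift μ, 0⟩
    rw [Equiv.symm_apply_apply]
  have h := near_dist_carrier_le i hβ1 hnear
  rw [e]
  show (geomT i.D).dist (β i.hN i.D i.hk (bI ⟨s, ν⟩)) (β i.hN i.D i.hk (bI ⟨s.shift μ, 0⟩)) ≤ rJ d ℓ
  exact h

/-- ★ **THE POINTWISE BOUND**: for contracting link variables, `|(J_μλ)(b′, ν, c, c′)| ≤ coordBound·basisBound·Σ_a |λ(chart(b′₋ + e_μ), ν, a, c′)|` (the coordinate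
of a vector is `≤ coordBound·‖·‖`, the conjugation contracts, the re-assembled slice has norm `≤ basisBound·Σ_a|λ_a|`; zero off the direction `μ`).
[cite: Balaban1985BackgroundPropagators, (3.3) p.390, (3.35) p.396 («U has values in G»), p.389 (coordinates), dictionary] -/
theorem abs_JcoKH_apply_le (μ : Fin (d + 1)) (U₁ : B.Cfg)
    (hU : ∀ (ν : Fin (d + 1)) (s : Site (PV d ℓ i.m i.K hd hL) 0), ‖(cfg U₁ ν s : 𝔸)‖ ≤ 1 ∧ ‖(((cfg U₁ ν s)⁻¹ : 𝔸ˣ) : 𝔸)‖ ≤ 1)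
    (lam : XSK κ i → ℝ) (p : XBK κ i) :
    |JcoKH i b B cfg μ U₁ lam p| ≤
      coordBound39 b * (basisBound39 b * ∑ a, |lam (chartY i (p.1.src.shift μ), p.2.1, a, p.2.2.2)|) := by
  have hcb : 0 ≤ coordBound39 b := norm_nonneg _
  have hbb : 0 ≤ basisBound39 b := Finset.sum_nonneg fun _ _ => norm_nonneg _
  rw [JcoKH_apply, Jb_apply]
  by_cases h : p.1.dir = μ
  · rw [if_pos h, map_neg, Finsupp.neg_apply, abs_neg]
    refine (abs_repr_le b _ _).trans (mul_le_mul_of_nonneg_left ?_ hcb)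
    exact (norm_R_le_of_contraction' (hU μ _).1 (hU μ _).2 _).trans (norm_sum_smul_basis_le b _)
  · rw [if_neg h, map_zero, Finsupp.zero_apply, abs_zero]
    exact mul_nonneg hcb (mul_nonneg hbb (Finset.sum_nonneg fun _ _ => abs_nonneg _))

/-- ★★ **THE SUP MAJORANT OF `J_μ(U₁)`, TWO-SPACE FORM**: from the site carrier `XSK` (block map `blkSK (sIK bI)`) to the bond carrier `XBK` (block map `blkBK bI`),
for `bI` 1-faithful and contracting link variables, `J_μ(U₁)` has the [4]-(2.51) majorant `cR39 b·e^{δ·rJ}·e^{−δd(y,y′)}` for every `δ ≥ 0`: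
`|(J_μλ)(p)| ≤ cR39 b·|λ|` and the value at `p` reads `λ` only on the block `sIK bI (chart(p₋ + e_μ))`, within `rJ` of `bI p`.
[cite: Balaban1985BackgroundPropagators, (3.3) p.390, (3.35) p.396, (3.133) p.422; Balaban1984PropagatorsII, (2.45)–(2.46) p.231, (2.51) p.232] -/
theorem hasMajorantHom_JcoKH
    (hβ1 : ∀ f : FBondY i, (geomT i.D).dist (β i.hN i.D i.hk (bI f)) (blkV1 i.hN i.D f) ≤ 1) {U₁ : B.Cfg}
    (hU : ∀ (ν : Fin (d + 1)) (s : Site (PV d ℓ i.m i.K hd hL) 0), ‖(cfg U₁ ν s : 𝔸)‖ ≤ 1 ∧ ‖(((cfg U₁ ν s)⁻¹ : 𝔸ˣ) : 𝔸)‖ ≤ 1)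
    {δ : ℝ} (hδ : 0 ≤ δ) (R₀ : ℝ) (H₀ : Prop) [Fintype (geo9K i).Site] (μ : Fin (d + 1)) :
    HasMajorantHom (g := toB6 (geo9K i) R₀ H₀) (blkSK i (sIK i bI)) (blkBK i bI) (JcoKH i b B cfg μ U₁)
      (fun a a' => cR39 b * (Real.exp (δ * rJ d ℓ) * Real.exp (-(δ * (geo9K i).dist a a')))) := by
  intro y' lam Bl hl p
  change IBondY i at y'
  set z : SiteY i := chartY i (p.1.src.shift μ) with hz
  have hpt := abs_JcoKH_apply_le i b B cfg μ U₁ hU lam p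
  have hK0 : 0 ≤ cR39 b * (Real.exp (δ * rJ d ℓ) * Real.exp (-(δ * (geo9K i).dist (blkBK i bI p) y'))) := by
    have := cR39_nonneg b
    positivity
  by_cases hsrc : sIK i bI z = y'
  · -- the input block is the block of the transported neighbour
    have hsum : ∑ a, |lam (z, p.2.1, a, p.2.2.2)| ≤ (Fintype.card κ : ℝ) * Bl := by
      calc ∑ a, |lam (z, p.2.1, a, p.2.2.2)| ≤ ∑ _a : κ, Bl := Finset.sum_le_sum fun a _ => hl.bound (z, p.2.1, a, p.2.2.2) hsrc
        _ = (Fintype.card κ : ℝ) * Bl := by rw [Finset.sum_const, nsmul_eq_mul, Finset.card_univ]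
    have hval : |JcoKH i b B cfg μ U₁ lam p| ≤ cR39 b * Bl := by
      refine hpt.trans ?_
      have hcb : 0 ≤ coordBound39 b := norm_nonneg _
      have hbb : 0 ≤ basisBound39 b := Finset.sum_nonneg fun _ _ => norm_nonneg _
      calc coordBound39 b * (basisBound39 b * ∑ a, |lam (z, p.2.1, a, p.2.2.2)|)
          ≤ coordBound39 b * (basisBound39 b * ((Fintype.card κ : ℝ) * Bl)) :=
            mul_le_mul_of_nonneg_left (mul_le_mul_of_nonneg_left hsum hbb) hcb
        _ = cR39 b * Bl := by simp only [cR39]; ring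
    have hnear : (geo9K i).dist (blkBK i bI p) y' ≤ rJ d ℓ := by
      rw [← hsrc]
      exact dist_bI_sIK_shift_le i hβ1 p.1.src μ p.1.dir
    have hK1 : 1 ≤ Real.exp (δ * rJ d ℓ) * Real.exp (-(δ * (geo9K i).dist (blkBK i bI p) y')) := by
      rw [← Real.exp_add]
      refine Real.one_le_exp ?_
      nlinarith [mul_le_mul_of_nonneg_left hnear hδ]
    calc |JcoKH i b B cfg μ U₁ lam p| ≤ cR39 b * Bl := hval
      _ = cR39 b * 1 * Bl := by rw [mul_one]
      _ ≤ cR39 b * (Real.exp (δ * rJ d ℓ) * Real.exp (-(δ * (geo9K i).dist (blkBK i bI p) y'))) * Bl :=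
          mul_le_mul_of_nonneg_right (mul_le_mul_of_nonneg_left hK1 (cR39_nonneg b)) hl.nonneg
  · -- the input vanishes at the transported neighbour
    have h0 : ∑ a, |lam (z, p.2.1, a, p.2.2.2)| = 0 :=
      Finset.sum_eq_zero fun a _ => by rw [hl.off (z, p.2.1, a, p.2.2.2) hsrc, abs_zero]
    rw [h0, mul_zero, mul_zero] at hpt
    exact hpt.trans (mul_nonneg hK0 hl.nonneg)

/-- ★★ **THE SUP MAJORANT OF `J_μ(U₁)`, CLASS FORM `𝔠_W⁽⁰⁾ → 𝔠⁽⁰⁾`** (the `hJ` input of `B9Thm313WholeDvFromDds.gD1_of_e2d ∕ gD2_of_e2d`):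
`HasMaj (cNorm … (blkSK (sIK bI)) _ 0) (cNorm … (blkBK bI) _ 0) (J_μ(U₁)) (cR39 b·e^{δ·rJ}·e^{−δd})`, every `δ ≥ 0`.
[cite: Balaban1985BackgroundPropagators, (3.3) p.390, (3.42) p.397, (3.133) p.422; Balaban1984PropagatorsII, (2.51) p.232] -/
theorem hasMaj_JcoKH
    (hβ1 : ∀ f : FBondY i, (geomT i.D).dist (β i.hN i.D i.hk (bI f)) (blkV1 i.hN i.D f) ≤ 1) {U₁ : B.Cfg}
    (hU : ∀ (ν : Fin (d + 1)) (s : Site (PV d ℓ i.m i.K hd hL) 0), ‖(cfg U₁ ν s : 𝔸)‖ ≤ 1 ∧ ‖(((cfg U₁ ν s)⁻¹ : 𝔸ˣ) : 𝔸)‖ ≤ 1)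
    {δ : ℝ} (hδ : 0 ≤ δ) {R₀ : ℝ} {H₀ : Prop} [Fintype (geo9K i).Site] (hlen : ∀ y : (geo9K i).Site, 0 ≤ (geo9K i).len y)
    (μ : Fin (d + 1)) :
    HasMaj (cNorm R₀ H₀ (blkSK i (sIK i bI)) hlen 0) (cNorm R₀ H₀ (blkBK i bI) hlen 0) (JcoKH i b B cfg μ U₁)
      (fun a a' => cR39 b * Real.exp (δ * rJ d ℓ) * Real.exp (-(δ * (geo9K i).dist a a'))) := by
  have hK0 : ∀ a a' : (geo9K i).Site, 0 ≤ cR39 b * (Real.exp (δ * rJ d ℓ) * Real.exp (-(δ * (geo9K i).dist a a'))) :=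
    fun a a' => by have := cR39_nonneg b; positivity
  have h0 := B9Thm37AllNorms.hasMaj_of_hasMajorantHom (G := toB6 (geo9K i) R₀ H₀) (blkSK i (sIK i bI)) (blkBK i bI) hK0
    (hasMajorantHom_JcoKH i b B cfg hβ1 hU hδ R₀ H₀ μ)
  show HasMaj (weightNorm (BlockNorm.ofBlocks (toB6 (geo9K i) R₀ H₀) (blkSK i (sIK i bI))) (wt (geo9K i) 0) (wt_nonneg hlen 0))
    (weightNorm (BlockNorm.ofBlocks (toB6 (geo9K i) R₀ H₀) (blkBK i bI)) (wt (geo9K i) 0) (wt_nonneg hlen 0)) _ _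
  refine B9SectDSup.HasMaj.weight (wt_nonneg hlen 0) (wt_nonneg hlen 0) h0 fun y y' => le_of_eq ?_
  simp only [wt, pow_zero, inv_one, one_mul, mul_one]
  ring

end Sup

/-! ## §4 At node00-def-Y's members: every `Reg335` configuration has contracting link variables; the sup letter at the certificate's pins -/

section Members

open scoped Matrix.Norms.L2Operator
open B7Prop2SpecialUnitary (specialUnitaryUnits specialUnitaryUnits_le_U1)
open B9PinMembersKLevelV1 (MemberY geo9Y bg9Y reg335Y_iff)
open B9BackgroundsKLevelV1 (mem_of_reg335)
open B9CoReadingCoordsTranspose (TrIdx trBasis)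

variable {Mstar : ℕ} {N : ℕ} [NeZero N]

/-- **A (3.35)-REGULAR CONFIGURATION OF A MEMBER HAS CONTRACTING LINK VARIABLES**: `Reg335` carries «`U` is `SU(N)`-valued» (def-Y's typing of p. 396), and
`SU(N) ≤ U1` (`‖u‖, ‖u⁻¹‖ ≤ 1`, `B7Prop2SpecialUnitary.specialUnitaryUnits_le_U1`). [cite: Balaban1985BackgroundPropagators, (3.35) p.396 («U has values in G»)] -/
theorem cfg_norm_le_one_of_reg335 (x : MemberY d ℓ hd hL b₀ b₁ Mstar) {c α₀ : ℝ}
    {U : (bg9Y (Matrix (Fin N) (Fin N) ℂ) (specialUnitaryUnits (Fin N)) x).Cfg}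
    (hU : (bg9Y (Matrix (Fin N) (Fin N) ℂ) (specialUnitaryUnits (Fin N)) x).Reg335 c α₀ U)
    (ν : Fin (d + 1)) (s : Site (PV d ℓ x.toKIdx.m x.toKIdx.K hd hL) 0) :
    ‖(U ν s : Matrix (Fin N) (Fin N) ℂ)‖ ≤ 1 ∧ ‖(((U ν s)⁻¹ : (Matrix (Fin N) (Fin N) ℂ)ˣ) : Matrix (Fin N) (Fin N) ℂ)‖ ≤ 1 :=
  specialUnitaryUnits_le_U1 (mem_of_reg335 x.toKIdx ((reg335Y_iff x c α₀ U).1 hU).1 ν s)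

variable [∀ x : MemberY d ℓ hd hL b₀ b₁ Mstar, Fintype (geo9Y x).Site]

/-- ★★ **THE SUP LETTER `J_μ(U)` AT THE CERTIFICATE'S PINS, EVERY MEMBER, EVERY REGULAR `U`** (the knit's `hJ12 x U μ`): at
`JcoKH x.toKIdx (trBasis N) (bg9Y …) (fun U => U) μ U`, block maps `blkSK (sIK (bI x))` (`hblkW12`) ∕ `blkBK (bI x)` (`hblk12`), `bI` 1-faithful (`hβ1`):
`HasMaj (cNorm R₀ H₀ (blkSK (sIK bI)) _ 0) (cNorm R₀ H₀ (blkBK bI) _ 0) (J_μ(U)) (cR39 (trBasis N)·e^{δ·rJ}·e^{−δd})`, every `δ ≥ 0`.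
[cite: Balaban1985BackgroundPropagators, (3.3) p.390, (3.35) p.396, (3.42) p.397, (3.133) p.422; Balaban1984PropagatorsII, (2.51) p.232] -/
theorem hasMaj_JcoKH_pins (x : MemberY d ℓ hd hL b₀ b₁ Mstar) {bI : FBondY x.toKIdx → IBondY x.toKIdx}
    (hβ1 : ∀ f : FBondY x.toKIdx, (geomT x.D).dist (β x.hN x.D x.hk (bI f)) (blkV1 x.hN x.D f) ≤ 1) {c α₀ : ℝ}
    {U : (bg9Y (Matrix (Fin N) (Fin N) ℂ) (specialUnitaryUnits (Fin N)) x).Cfg}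
    (hU : (bg9Y (Matrix (Fin N) (Fin N) ℂ) (specialUnitaryUnits (Fin N)) x).Reg335 c α₀ U)
    {δ : ℝ} (hδ : 0 ≤ δ) {R₀ : ℝ} {H₀ : Prop} (hlen : ∀ y : (geo9Y x).Site, 0 ≤ (geo9Y x).len y) (μ : Fin (d + 1)) :
    HasMaj (cNorm R₀ H₀ (blkSK x.toKIdx (sIK x.toKIdx bI)) hlen 0) (cNorm R₀ H₀ (blkBK x.toKIdx bI) hlen 0)
      (JcoKH x.toKIdx (trBasis N) (bg9Y (Matrix (Fin N) (Fin N) ℂ) (specialUnitaryUnits (Fin N)) x) (fun U => U) μ U)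
      (fun a a' => cR39 (trBasis N) * Real.exp (δ * rJ d ℓ) * Real.exp (-(δ * (geo9Y x).dist a a'))) := by
  letI : Fintype (geo9K x.toKIdx).Site := (inferInstance : Fintype (geo9Y x).Site)
  exact hasMaj_JcoKH x.toKIdx (trBasis N) (bg9Y (Matrix (Fin N) (Fin N) ℂ) (specialUnitaryUnits (Fin N)) x) (fun U => U)
    hβ1 (cfg_norm_le_one_of_reg335 x hU) hδ hlen μ

end Members

end Literature.MathematicalPhysics.QuantumFieldTheory.Balaban1983to89.B9GradViaDivLettersAtPins

end
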